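import Mathlib
import Summits.Ventures.PercRepro.TriangleCapEightThirteenB

/-!
# PercRepro — THE CELL `(8, 13)`, PART C: A FAMILY OF FOUR TRIANGLES ON EIGHT VERTICES (p3, gen 37; part 75)

For a family `F` of four triangles of a `K₄⁻`-free graph (every member `{u, v, w}` a triangle):
* `inter_card_le_one_of_mem` — two distinct members share at most one vertex;
* `exists_not_mem_of_four` — no vertex of an `8`-vertex graph lies in all four (it would have eight neighbours);
* **`outer_of_two_through`** — if an edge `x y` lies in no member, `x` lies in two members and `y` in one, then
  some member has an outer vertex (the third vertex of a triangle through `x` is adjacent to nothing of the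
  triangle through `y`).
Axioms: standard.
-/

namespace PercRepro

namespace TriangleCap

namespace C047

open Finset

variable {V : Type*} [Fintype V] [DecidableEq V]

/-- Two distinct triangles of a `K₄⁻`-free graph share at most one vertex. -/
theorem inter_card_le_one_of_mem (D : SimpleGraph V) [DecidableRel D.Adj] (hK : K4mFree D) {T T' : Finset V}
    (hT : ∃ u v w, D.Adj u v ∧ D.Adj u w ∧ D.Adj v w ∧ T = {u, v, w})
    (hT' : ∃ u v w, D.Adj u v ∧ D.Adj u w ∧ D.Adj v w ∧ T' = {u, v, w}) (hne : T ≠ T') :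
    (T ∩ T').card ≤ 1 := by
  obtain ⟨u, v, w, huv, huw, hvw, rfl⟩ := hT
  obtain ⟨u', v', w', huv', huw', hvw', rfl⟩ := hT'
  apply card_le_one.mpr
  intro a ha b hb
  by_contra hab
  rw [mem_inter] at ha hb
  have hadj : D.Adj a b := clique_triple D huv huw hvw a ha.1 b hb.1 hab
  have hd := pairs_disjoint_of_ne D hK huv huw hvw huv' huw' hvw' hne
  rw [disjoint_left] at hd
  have h1 : (a, b) ∈ (({u, v, w} : Finset V) ×ˢ ({u, v, w} : Finset V)).filter
      (fun p : V × V => D.Adj p.1 p.2) := mem_filter.mpr ⟨mem_product.mpr ⟨ha.1, hb.1⟩, hadj⟩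
  have h2 : (a, b) ∈ (({u', v', w'} : Finset V) ×ˢ ({u', v', w'} : Finset V)).filter
      (fun p : V × V => D.Adj p.1 p.2) := mem_filter.mpr ⟨mem_product.mpr ⟨ha.2, hb.2⟩, hadj⟩
  exact hd h1 h2

/-- A vertex of a graph on `8` vertices does not lie in all four triangles of a family of four. -/
theorem exists_not_mem_of_four (D : SimpleGraph V) [DecidableRel D.Adj] (hK : K4mFree D)
    (hk : Fintype.card V = 8) (F : Finset (Finset V)) (hF4 : F.card = 4)
    (hF : ∀ T ∈ F, ∃ u v w, D.Adj u v ∧ D.Adj u w ∧ D.Adj v w ∧ T = {u, v, w}) (x : V) :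
    ∃ T ∈ F, x ∉ T := by
  by_contra hall
  simp only [not_exists, not_and, not_not] at hall
  -- the sets `T.erase x` are pairwise disjoint and lie in `N(x)`
  have hdisj : ∀ T ∈ F, ∀ T' ∈ F, T ≠ T' → Disjoint (T.erase x) (T'.erase x) := by
    intro T hT T' hT' hne
    rw [disjoint_left]
    intro a ha ha'
    rw [mem_erase] at ha ha'
    have h := inter_card_le_one_of_mem D hK (hF T hT) (hF T' hT') hne
    have hx : x ∈ T ∩ T' := mem_inter.mpr ⟨hall T hT, hall T' hT'⟩
    have ha2 : a ∈ T ∩ T' := mem_inter.mpr ⟨ha.2, ha'.2⟩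
    exact ha.1 (card_le_one.mp h a ha2 x hx)
  have hsub : F.biUnion (fun T => T.erase x) ⊆ univ.filter (fun z => D.Adj x z) := by
    intro a ha
    rw [mem_biUnion] at ha
    obtain ⟨T, hT, ha⟩ := ha
    rw [mem_erase] at ha
    obtain ⟨u, v, w, huv, huw, hvw, rfl⟩ := hF T hT
    rw [mem_filter]
    exact ⟨mem_univ _, clique_triple D huv huw hvw x (hall _ hT) a ha.2 (Ne.symm ha.1)⟩
  have hcard : (F.biUnion (fun T => T.erase x)).card = 8 := by
    rw [card_biUnion hdisj]
    have : ∀ T ∈ F, (T.erase x).card = 2 := by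
      intro T hT
      obtain ⟨u, v, w, huv, huw, hvw, rfl⟩ := hF T hT
      rw [card_erase_of_mem (hall _ hT), card_triple huv.ne huw.ne hvw.ne]
    rw [sum_congr rfl this, sum_const, hF4, smul_eq_mul]
  have h1 := card_le_card hsub
  have h2 : (univ.filter (fun z => D.Adj x z)).card ≤ Fintype.card V - 1 := by
    have : univ.filter (fun z => D.Adj x z) ⊆ univ.erase x := by
      intro z hz
      rw [mem_filter] at hz
      rw [mem_erase]
      exact ⟨hz.2.ne.symm, mem_univ _⟩
    have := card_le_card this
    rwa [card_erase_of_mem (mem_univ x), card_univ] at this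
  omega

/-- **AN OUTER VERTEX FROM AN EDGE LYING IN NO TRIANGLE, ONE END IN TWO TRIANGLES, THE OTHER IN ONE.** -/
theorem outer_of_two_through (D : SimpleGraph V) [DecidableRel D.Adj] (hK : K4mFree D)
    (hk : Fintype.card V = 8) (F : Finset (Finset V)) (hF4 : F.card = 4)
    (hF : ∀ T ∈ F, ∃ u v w, D.Adj u v ∧ D.Adj u w ∧ D.Adj v w ∧ T = {u, v, w})
    (hT : ∀ x y z, D.Adj x y → D.Adj x z → D.Adj y z → ∃ T ∈ F, x ∈ T ∧ y ∈ T)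
    {x y : V} (hxy : D.Adj x y)
    (hmem : ∀ v z, D.Adj v z → (∃ T ∈ F, v ∈ T ∧ z ∈ T) ∨ (v = x ∧ z = y) ∨ (v = y ∧ z = x))
    (hxyU : ∀ T ∈ F, ¬ (x ∈ T ∧ y ∈ T))
    {A B C : Finset V} (hA : A ∈ F) (hB : B ∈ F) (hC : C ∈ F) (hAB : A ≠ B) (hxA : x ∈ A) (hxB : x ∈ B)
    (hyC : y ∈ C) : ∃ T ∈ F, ∃ z, ∀ t ∈ T, ¬ D.Adj t z := by
  have hcl : ∀ T ∈ F, ∀ a ∈ T, ∀ b ∈ T, a ≠ b → D.Adj a b := by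
    intro T hT
    obtain ⟨u, v, w, huv, huw, hvw, rfl⟩ := hF T hT
    exact clique_triple D huv huw hvw
  have hc3 : ∀ T ∈ F, T.card = 3 := by
    intro T hT
    obtain ⟨u, v, w, huv, huw, hvw, rfl⟩ := hF T hT
    exact card_triple huv.ne huw.ne hvw.ne
  have hint : ∀ T ∈ F, ∀ T' ∈ F, T ≠ T' → (T ∩ T').card ≤ 1 := fun T hT T' hT' hne =>
    inter_card_le_one_of_mem D hK (hF T hT) (hF T' hT') hne
  have hxC : x ∉ C := fun h => hxyU C hC ⟨h, hyC⟩
  have hyA : y ∉ A := fun h => hxyU A hA ⟨hxA, h⟩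
  have hyB : y ∉ B := fun h => hxyU B hB ⟨hxB, h⟩
  have hCA : C ≠ A := fun h => hyA (h ▸ hyC)
  have hCB : C ≠ B := fun h => hyB (h ▸ hyC)
  -- `C` is disjoint from `A` and from `B`
  have hdisjCA : Disjoint C A := by
    rw [disjoint_left]
    intro r hrC hrA
    have hrx : r ≠ x := fun h => hxC (h ▸ hrC)
    have hry : r ≠ y := fun h => hyA (h ▸ hrA)
    obtain ⟨T, hTF, hT1, hT2⟩ := hT x y r hxy (hcl A hA x hxA r hrA hrx.symm) (hcl C hC y hyC r hrC hry.symm)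
    exact hxyU T hTF ⟨hT1, hT2⟩
  have hdisjCB : Disjoint C B := by
    rw [disjoint_left]
    intro r hrC hrB
    have hrx : r ≠ x := fun h => hxC (h ▸ hrC)
    have hry : r ≠ y := fun h => hyB (h ▸ hrB)
    obtain ⟨T, hTF, hT1, hT2⟩ := hT x y r hxy (hcl B hB x hxB r hrB hrx.symm) (hcl C hC y hyC r hrC hry.symm)
    exact hxyU T hTF ⟨hT1, hT2⟩
  -- `A ∪ B ∪ C = univ`
  have hAB1 : (A ∩ B).card = 1 := by
    have h1 := hint A hA B hB hAB
    have h2 : 0 < (A ∩ B).card := card_pos.mpr ⟨x, mem_inter.mpr ⟨hxA, hxB⟩⟩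
    omega
  have hABcard : (A ∪ B).card = 5 := by
    have := card_union_add_card_inter A B
    rw [hAB1, hc3 A hA, hc3 B hB] at this
    omega
  have hABC : (A ∪ B ∪ C).card = 8 := by
    rw [card_union_of_disjoint (disjoint_union_left.mpr ⟨hdisjCA.symm, hdisjCB.symm⟩), hABcard, hc3 C hC]
  have huniv : A ∪ B ∪ C = univ := eq_univ_of_card _ (by rw [hABC, hk])
  -- the fourth triangle `E`
  have hsub3 : ({A, B, C} : Finset (Finset V)) ⊆ F := by
    intro T hT
    simp only [mem_insert, mem_singleton] at hT
    rcases hT with rfl | rfl | rfl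
    · exact hA
    · exact hB
    · exact hC
  have hcard3 : ({A, B, C} : Finset (Finset V)).card = 3 := card_triple hAB hCA.symm hCB.symm
  have hE1 : (F \ {A, B, C}).card = 1 := by
    rw [card_sdiff, inter_eq_left.mpr hsub3, hF4, hcard3]
  obtain ⟨E, hE⟩ := card_eq_one.mp hE1
  have hEF : E ∈ F := by
    have : E ∈ F \ {A, B, C} := by rw [hE]; exact mem_singleton_self E
    exact (mem_sdiff.mp this).1
  have hEnot : E ∉ ({A, B, C} : Finset (Finset V)) := by
    have : E ∈ F \ {A, B, C} := by rw [hE]; exact mem_singleton_self E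
    exact (mem_sdiff.mp this).2
  simp only [mem_insert, mem_singleton, not_or] at hEnot
  obtain ⟨hEA, hEB, hEC⟩ := hEnot
  -- every member of `F` is one of `A, B, C, E`
  have hmemF : ∀ T ∈ F, T = A ∨ T = B ∨ T = C ∨ T = E := by
    intro T hT
    by_contra hne
    simp only [not_or] at hne
    have : T ∈ F \ {A, B, C} := mem_sdiff.mpr ⟨hT, by
      simp only [mem_insert, mem_singleton, not_or]; exact ⟨hne.1, hne.2.1, hne.2.2.1⟩⟩
    rw [hE, mem_singleton] at this
    exact hne.2.2.2 this
  -- `x ∉ E`, and `E` meets `A` in exactly one vertex `p ≠ x`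
  have hEsub : ∀ e ∈ E, e ∈ A ∨ e ∈ B ∨ e ∈ C := by
    intro e _
    have : e ∈ A ∪ B ∪ C := by rw [huniv]; exact mem_univ e
    rw [mem_union, mem_union] at this
    tauto
  have hEA1 := hint E hEF A hA hEA
  have hEB1 := hint E hEF B hB hEB
  have hEC1 := hint E hEF C hC hEC
  have hEcard := hc3 E hEF
  -- `|E| ≤ |E ∩ A| + |E ∩ B| + |E ∩ C|`
  have hEle : E.card ≤ (E ∩ A).card + (E ∩ B).card + (E ∩ C).card := by
    have : E ⊆ (E ∩ A) ∪ (E ∩ B) ∪ (E ∩ C) := by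
      intro e he
      rw [mem_union, mem_union, mem_inter, mem_inter, mem_inter]
      rcases hEsub e he with h | h | h
      · exact Or.inl (Or.inl ⟨he, h⟩)
      · exact Or.inl (Or.inr ⟨he, h⟩)
      · exact Or.inr ⟨he, h⟩
    have := card_le_card this
    have h1 := card_union_le ((E ∩ A) ∪ (E ∩ B)) (E ∩ C)
    have h2 := card_union_le (E ∩ A) (E ∩ B)
    omega
  have hEA' : (E ∩ A).card = 1 := by omega
  obtain ⟨p, hp⟩ := card_eq_one.mp hEA'
  have hpE : p ∈ E := (mem_inter.mp (by rw [hp]; exact mem_singleton_self p)).1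
  have hpA : p ∈ A := (mem_inter.mp (by rw [hp]; exact mem_singleton_self p)).2
  have hxE : x ∉ E := by
    intro hxE
    -- then `x ∈ E ∩ A` and `x ∈ E ∩ B`, and the two other vertices of `E` lie in `C`
    have hpx : p = x := by
      have : x ∈ E ∩ A := mem_inter.mpr ⟨hxE, hxA⟩
      rw [hp, mem_singleton] at this
      exact this.symm
    subst hpx
    have hEB' : E ∩ B = {p} := by
      apply eq_of_subset_of_card_le
      · intro e he
        rw [mem_singleton]
        have : (E ∩ B).card ≤ 1 := hEB1
        exact card_le_one.mp this e he p (mem_inter.mpr ⟨hxE, hxB⟩)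
      · rw [card_singleton]; exact card_pos.mpr ⟨p, mem_inter.mpr ⟨hxE, hxB⟩⟩
    -- `E ∖ {p} ⊆ C`, two vertices
    have hsubC : E.erase p ⊆ E ∩ C := by
      intro e he
      rw [mem_erase] at he
      rw [mem_inter]
      refine ⟨he.2, ?_⟩
      rcases hEsub e he.2 with h | h | h
      · have : e ∈ E ∩ A := mem_inter.mpr ⟨he.2, h⟩
        rw [hp, mem_singleton] at this
        exact absurd this he.1
      · have : e ∈ E ∩ B := mem_inter.mpr ⟨he.2, h⟩
        rw [hEB', mem_singleton] at this
        exact absurd this he.1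
      · exact h
    have := card_le_card hsubC
    rw [card_erase_of_mem hpE, hEcard] at this
    omega
  have hpx : p ≠ x := fun h => hxE (h ▸ hpE)
  -- the third vertex `p'` of `A`
  have hA2 : ((A.erase x).erase p).card = 1 := by
    rw [card_erase_of_mem (mem_erase.mpr ⟨hpx, hpA⟩), card_erase_of_mem hxA, hc3 A hA]
  obtain ⟨p', hp'⟩ := card_eq_one.mp hA2
  have hp'mem : p' ∈ (A.erase x).erase p := by rw [hp']; exact mem_singleton_self p'
  rw [mem_erase, mem_erase] at hp'mem
  obtain ⟨hp'p, hp'x, hp'A⟩ := hp'mem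
  refine ⟨C, hC, p', ?_⟩
  intro t htC hadj
  have hp'C : p' ∉ C := fun h => disjoint_left.mp hdisjCA h hp'A
  have hp'B : p' ∉ B := by
    intro h
    have : p' ∈ A ∩ B := mem_inter.mpr ⟨hp'A, h⟩
    have hxAB : x ∈ A ∩ B := mem_inter.mpr ⟨hxA, hxB⟩
    exact hp'x (card_le_one.mp (hint A hA B hB hAB) p' this x hxAB)
  have hp'E : p' ∉ E := by
    intro h
    have : p' ∈ E ∩ A := mem_inter.mpr ⟨h, hp'A⟩
    rw [hp, mem_singleton] at this
    exact hp'p this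
  rcases hmem t p' hadj with ⟨T, hTF, htT, hp'T⟩ | ⟨rfl, rfl⟩ | ⟨rfl, rfl⟩
  · rcases hmemF T hTF with rfl | rfl | rfl | rfl
    · exact disjoint_left.mp hdisjCA htC htT
    · exact hp'B hp'T
    · exact hp'C hp'T
    · exact hp'E hp'T
  · exact hxC htC
  · exact hp'x rfl

end C047

end TriangleCap

end PercRepro
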